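import Literature.Computability.Complexity.NSubexpKarp
import Literature.Computability.Complexity.RootClock
import Literature.Computability.Complexity.TruncMapMachine
import HarnessLib

/-!
# `NSUBEXP` is closed downwards under Karp reductions (discharge)

Sibling proof file of `NSubexpKarp.lean`, for the named fact
`Literature.Computability.Complexity.NSUBEXP_of_karpReducible` (Kabanets–Impagliazzo 2003, §2.1,
`NSUBEXP = ∩_{ε>0} NTIME(2^{n^ε})`, and proof of Cor. 12, p. 358, where Lemma 11 — "ACP … is
polynomial-time many-one reducible to ACIT" — is combined with "ACIT ∈ NSUBEXP"):
**`NSUBEXP_of_karpReducible_holds`**, `L ≤ₚ L' → L' ∈ NSUBEXP → L ∈ NSUBEXP` for the tree's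
verifier-form `NTIME` (`Nondeterministic.lean`) and `NSUBEXP = ⋂_{r>0} NTIME(2^{⌊n^{1/r}⌋})`
(`NSubexp.lean`).

## The verifier

Let `f ∈ FP` reduce `L` to `L'` (`x ∈ L ↔ f x ∈ L'`), `|f x| ≤ A |x|^d + A` with `d ≥ 1`
(`exists_length_le_of_mem_FP`), and let `r ≥ 1`. Take the member `r' = 2dr` of the `NSUBEXP`
presentation of `L'`: a constant `c'`, a relation `R'` and a machine `M'` deciding `R' w z` on
`boolPair w z` within `c' · 2^{⌊|w|^{1/r'}⌋} + c'` steps for the certificates `z` inside that bound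
(and unspecified beyond it). The verifier of `L` for the bound `2^{⌊n^{1/r}⌋}` is the composite
(Mathlib `TM2`, sequential composition with additive time, `TM2ComputableAux.comp_outputsWithin`)

  `V = truncMapAux (U ⨟ N₀) ⨟ M'`,

where `U` is the `FP` machine of `f` and `N₀` the compiled **exact root clock**
`t ↦ ⟨t, 1^{c' · 2^{⌊|t|^{1/r'}⌋} + c'}⟩` (`KarpClock.prog`, this file: the program `RootClock.prog` of
`RootClock.lean` with its flag symbol popped again, so that the clock is EXACTLY the admissible
certificate length of `M'`), so that the tree's truncating wrapper (`TruncMapMachine.lean`) maps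
`⟨x, y⟩` to `⟨f x, y ↾ (c' · 2^{⌊|f x|^{1/r'}⌋} + c')⟩`, reading the discarded part of `y` two symbols
per step. Its relation is `R x y = R' (f x) (y ↾ (c' · 2^{⌊|f x|^{1/r'}⌋} + c'))` (`KarpClock.newRel`).

* Correctness: `x ∈ L ↔ f x ∈ L' ↔ ∃ z` inside the bound with `R' (f x) z`; such a `z` is its own
  truncation, and conversely a truncated witness is inside the bound.
* Time (`KarpClock.outputsWithin_verifier`, `KarpClock.exists_time_bound`):
  `|y|/2 + q(n) + P(|f x|) + (3c' + K) · 2^{⌊|f x|^{1/r'}⌋} + O(|f x| + n)`; by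
  `⌊(A n^d + A)^{1/(2dr)}⌋ ≤ ⌊n^{1/r}⌋ + K'` (`PolyExistsNTIME.exists_two_pow_nthRoot_poly_le`) and
  "polynomials are `≤ C · 2^{⌊n^{1/r}⌋} + C`" (`PolyExistsNTIME.exists_poly_le_two_pow_nthRoot`,
  `PolyExistsNTIMEArith.lean`) this is `≤ |y|/2 + C · 2^{⌊n^{1/r}⌋} + C`, and with
  `|y| ≤ c · 2^{⌊n^{1/r}⌋} + c`, `c = 2C + 2`, within the budget of the tree's `NTIME`.

## References

* V. Kabanets, R. Impagliazzo, *Derandomizing polynomial identity tests means proving circuit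
  lower bounds*, STOC 2003, §2.1 (p. 357: `NSUBEXP = ∩_{ε>0} NTIME(2^{n^ε})`), Lemma 11 and the
  proof of Cor. 12 (p. 358). doi:10.1145/780542.780595
* S. Arora, B. Barak, *Computational Complexity: A Modern Approach*, CUP 2009, Thm. 2.8 (closure
  under `≤ₚ`), Def. 2.1 / §2.1.2 (verifier form of nondeterministic time), §1.3 (machine
  constructions and composition).
* T. Nipkow, G. Klein, *Concrete Semantics with Isabelle/HOL*, Springer 2014, Ch. 7 (big-step
  cost semantics) — the verification style of `SymbolPrograms.lean`.
-/

namespace Literature.Computability.Complexity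

open _root_.Computability Turing Polynomial
open scoped Notation

namespace KarpClock

/-! ### The exact root clock as a timed stack program -/

section Program

open ACom PolyExistsNTIME RootClock
open ExpPad (un cExp)

/-- **The exact root clock** `karpClock r' c' t = ⟨t, 1^{c' · 2^{⌊|t|^{1/r'}⌋} + c'}⟩`: the payload
`t` followed by the admissible certificate length of an `NTIME(2^{⌊m^{1/r'}⌋})` verifier with
constant `c'`, in unary (no flag symbol, unlike `rootClock` of `RootClock.lean`). [folklore] -/
def karpClock (r' c' : ℕ) (t : List Bool) : List Bool :=
  boolPair t (List.replicate (c' * 2 ^ Nat.nthRoot r' t.length + c') true)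

/-- The components of the clock word. [folklore] -/
@[simp] theorem boolUnpair_karpClock (r' c' : ℕ) (t : List Bool) :
    boolUnpair (karpClock r' c' t) =
      (t, List.replicate (c' * 2 ^ Nat.nthRoot r' t.length + c') true) := by
  simp [karpClock]

/-- **The exact root clock program**: the root clock program of `RootClock.lean` (split the input
into a reversed copy and its unary length, take the integer root, exponentiate by doubling, emit
`1^{c' · 2^s + c' + 1}`), then pop the extra flag symbol, emit the doubled copy of `t` and clean
up. [folklore] -/
def prog (r' c' : ℕ) : Prog :=
  split ;; moveNM ;; push .e true ;; rootLoop r' ;; push .e true ;; (loop .s fun _ => dblE) ;;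
  emitB c' ;; pop .out (fun _ => skip) ;; emitX ;; clear .m

/-- **Cost of the exact root clock program** on inputs of length `n`: two steps more than
`RootClock.cost` (the `pop`). [folklore] -/
def cost (r' c' n : ℕ) : ℕ := RootClock.cost r' c' n + 2

/-- **Specification of the exact root clock program** (`r' ≠ 0`): from the input store holding
`t` to the output store holding `karpClock r' c' t`, within `cost r' c' |t|` steps. [folklore] -/
theorem runs_prog {r' : ℕ} (hr' : r' ≠ 0) (c' : ℕ) (t : List Bool) :
    Runs (prog r' c') (AStore.single .inp t) (AStore.single .out (karpClock r' c' t))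
      (cost r' c' t.length) := by
  rw [single_inp, single_out]
  set n := t.length with hn
  have h1 := runs_split t
  rw [← hn] at h1
  have h2 := runs_moveNM [] t.reverse [] [] [] [] [] [] [] [] [] n 0
  simp only [Nat.add_zero] at h2
  have h3 : Runs (push Rg.e true) (mk [] t.reverse [] [] [] [] (un n) [] [] [] [] [] [])
      (mk [] t.reverse [] [] [] [] (un n) [] [true] [] [] [] []) 1 := Runs.push' (by simp)
  have h4 := runs_root hr' [] t.reverse [] [] [] [] [] n
  set s := Nat.nthRoot r' n with hs
  have h5 : Runs (push Rg.e true) (mk [] t.reverse [] [] [] [] (un n) (un s) [] [] [] [] [])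
      (mk [] t.reverse [] [] [] [] (un n) (un s) (un 1) [] [] [] []) 1 :=
    Runs.push' (by simp [un])
  have h6 := runs_exp2 [] t.reverse [] [] [] [] (un n) [] [] [] s 1
  rw [one_mul] at h6
  have h7 := runs_emitB c' [] t.reverse [] [] [] [] (un n) [] [] [] (2 ^ s)
  have h8 : Runs (pop Rg.out fun _ => skip)
      (mk [] t.reverse [] [] [] [] (un n) [] [] [] [] [] (un (c' * 2 ^ s + c' + 1)))
      (mk [] t.reverse [] [] [] [] (un n) [] [] [] [] [] (un (c' * 2 ^ s + c'))) (0 + 2) := by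
    refine Runs.pop_cons (a := true) (w := un (c' * 2 ^ s + c')) rfl ?_
    rw [update_mk_out]
    exact Runs.skip _
  have h9 := runs_emitX t (un n) (un (c' * 2 ^ s + c'))
  have h10 := runs_clear (Γ := Bool) Rg.m
    (mk [] [] [] [] [] [] (un n) [] [] [] [] [] (boolPair t (un (c' * 2 ^ s + c'))))
  simp only [mk_m, update_mk_m, un, List.length_replicate] at h10
  have := h1.seq (h2.seq (h3.seq (h4.seq (h5.seq (h6.seq (h7.seq (h8.seq (h9.seq h10))))))))
  unfold prog
  refine this.of_eq ?_ ?_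
  · simp [karpClock, ← hs, ← hn]
  · simp only [cost, RootClock.cost, ← hs]
    omega

end Program

/-! ### The clock machines -/

/-- **The exact root clock is computed by a multi-stack machine within `cost r' c' |t| + 1`
steps** (the structured program `KarpClock.prog r' c'` compiled by `ACom.exists_computesInTime`).
[folklore] -/
theorem exists_computesInTime_karpClock {r' : ℕ} (hr' : r' ≠ 0) (c' : ℕ) :
    ∃ M : TM2ComputableAux Bool Bool,
      ComputesInTime (id : List Bool → List Bool) id (karpClock r' c')
        (fun t => cost r' c' t.length + 1) M :=
  ACom.exists_computesInTime (prog r' c') .inp .out id id (karpClock r' c')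
    (fun t => cost r' c' t.length) (runs_prog hr' c')

/-- **The exact root clock machine**: for `r' ≠ 0` some `TM2` machine maps every `t` to
`karpClock r' c' t = ⟨t, 1^{c' · 2^{⌊|t|^{1/r'}⌋} + c'}⟩` within `P(|t|) + K · 2^{⌊|t|^{1/r'}⌋}` steps,
`P` a polynomial. [cite: AroraBarakCC2009, §1.3 (machine constructions)] -/
theorem exists_karpClock_machine {r' : ℕ} (hr' : r' ≠ 0) (c' : ℕ) :
    ∃ (P : Polynomial ℕ) (K : ℕ) (N : TM2ComputableAux Bool Bool), ∀ t : List Bool,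
      N.OutputsWithin t (karpClock r' c' t) (P.eval t.length + K * 2 ^ Nat.nthRoot r' t.length) := by
  obtain ⟨P, K, hPK⟩ := RootClock.exists_cost_le r' c'
  obtain ⟨N, hN⟩ := exists_computesInTime_karpClock hr' c'
  refine ⟨P + C 2, K, N, fun t => (hN t).mono ?_⟩
  have h := hPK t.length
  simp only [cost, eval_add, eval_C]
  omega

/-- **The clock behind the reduction**: for `f ∈ FP` and `r' ≠ 0` some machine maps every `x` to
`karpClock r' c' (f x) = ⟨f x, 1^{c' · 2^{⌊|f x|^{1/r'}⌋} + c'}⟩` within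
`q(|x|) + P(|f x|) + K · 2^{⌊|f x|^{1/r'}⌋}` steps (`q`, `P` polynomials): the `FP` machine of `f`
followed by the exact root clock machine. [cite: AroraBarakCC2009, §1.3 (machine constructions)] -/
theorem exists_clockMachine {f : List Bool → List Bool} (hf : f ∈ FP) {r' : ℕ} (hr' : r' ≠ 0)
    (c' : ℕ) :
    ∃ (q P : Polynomial ℕ) (K : ℕ) (N : TM2ComputableAux Bool Bool), ∀ x : List Bool,
      N.OutputsWithin x (karpClock r' c' (f x))
        (q.eval x.length + P.eval (f x).length + K * 2 ^ Nat.nthRoot r' (f x).length) := by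
  obtain ⟨q, U, hU⟩ := hf
  obtain ⟨P, K, Ck, hCk⟩ := exists_karpClock_machine hr' c'
  refine ⟨q, P, K, U.comp Ck, fun x => ?_⟩
  have h := TM2ComputableAux.comp_outputsWithin U Ck (hU x) (hCk (f x))
  refine h.mono ?_
  simp only [id]
  omega

/-! ### Arithmetic -/

/-- An `FP` function has polynomially bounded output length, in the arithmetic shape
`|f x| ≤ A |x|^d + A` with `d ≠ 0` (from `OutputsWithin.length_le` and
`exists_eval_le_mul_pow_add`). [cite: AroraBarakCC2009, §1.3] -/
theorem exists_length_le_of_mem_FP {f : List Bool → List Bool} (hf : f ∈ FP) :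
    ∃ A d : ℕ, d ≠ 0 ∧ ∀ x : List Bool, (f x).length ≤ A * x.length ^ d + A := by
  obtain ⟨p, M, hM⟩ := hf
  obtain ⟨c₁, d₁, h⟩ := exists_eval_le_mul_pow_add (X + C (TM2Comp.machinePushBound M.tm) * p)
  refine ⟨2 * c₁, d₁ + 1, Nat.succ_ne_zero d₁, fun x => ?_⟩
  have h1 : (f x).length ≤ c₁ * x.length ^ d₁ + c₁ := by
    have hl := (hM x).length_le
    have h' := h x.length
    simp only [id, eval_add, eval_X, eval_mul, eval_C] at hl h'
    exact hl.trans h'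
  have hpow : x.length ^ d₁ ≤ x.length ^ (d₁ + 1) + 1 := by
    rcases Nat.eq_zero_or_pos x.length with h0 | hpos
    · rw [h0]
      rcases Nat.eq_zero_or_pos d₁ with rfl | hd
      · simp
      · simp [Nat.zero_pow hd]
    · exact (Nat.pow_le_pow_right hpos (Nat.le_succ d₁)).trans (Nat.le_add_right _ _)
  have e := Nat.mul_le_mul_left c₁ hpow
  rw [Nat.mul_add, Nat.mul_one] at e
  rw [Nat.mul_assoc]
  omega

open PolyExistsNTIME in
/-- **The subexponential time bound**: for `d, r ≠ 0`, `r' = 2dr` and `m ≤ A n^d + A` (the length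
of `f x`), the running time of the composite verifier apart from the witness term `|y|/2`, and the
admissible certificate length `c' · 2^{⌊m^{1/r'}⌋} + c'` of the inner verifier, are both
`≤ C · 2^{⌊n^{1/r}⌋} + C` for one constant `C`. [folklore] -/
theorem exists_time_bound (q P : Polynomial ℕ) (K c' A : ℕ) {d r : ℕ} (hd : d ≠ 0) (hr : r ≠ 0) :
    ∃ Cb : ℕ, ∀ n m : ℕ, m ≤ A * n ^ d + A →
      c' * 2 ^ Nat.nthRoot (2 * d * r) m + c' +
          (q.eval n + P.eval m + K * 2 ^ Nat.nthRoot (2 * d * r) m + 3 * m +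
            2 * (c' * 2 ^ Nat.nthRoot (2 * d * r) m + c') + 2 * n + 11) ≤
        Cb * 2 ^ Nat.nthRoot r n + Cb ∧
      c' * 2 ^ Nat.nthRoot (2 * d * r) m + c' ≤ Cb * 2 ^ Nat.nthRoot r n + Cb := by
  obtain ⟨D, hD⟩ := exists_two_pow_nthRoot_poly_le A hd hr
  obtain ⟨CQ, hCQ⟩ := exists_poly_le_two_pow_nthRoot
    (q + P.comp (C A * X ^ d + C A) + C 3 * (C A * X ^ d + C A) + C 2 * X + C (3 * c' + 11)) hr
  refine ⟨CQ + (3 * c' + K) * D + c' * D + c', fun n m hm => ?_⟩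
  have h2dr : 2 * d * r ≠ 0 := Nat.mul_ne_zero (Nat.mul_ne_zero two_ne_zero hd) hr
  have hE : 2 ^ Nat.nthRoot (2 * d * r) m ≤ D * 2 ^ Nat.nthRoot r n :=
    (Nat.pow_le_pow_right Nat.two_pos (nthRoot_mono_right h2dr hm)).trans (hD n)
  have hP : P.eval m ≤ P.eval (A * n ^ d + A) := TM2Iter.eval_mono P hm
  have hQ := hCQ n
  simp only [eval_add, eval_mul, eval_C, eval_X, eval_pow, eval_comp] at hQ
  set T := 2 ^ Nat.nthRoot r n with hT
  set E := 2 ^ Nat.nthRoot (2 * d * r) m with hE'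
  have h3 := Nat.mul_le_mul_left (3 * c' + K) hE
  have h4 := Nat.mul_le_mul_left c' hE
  constructor
  · linarith [Nat.zero_le (c' * D * T), Nat.zero_le (c' * T), Nat.zero_le (c' * D),
      Nat.zero_le (K * D), Nat.zero_le (CQ * T)]
  · linarith [Nat.zero_le (c' * D * T), Nat.zero_le (c' * T), Nat.zero_le (c' * D),
      Nat.zero_le (K * D), Nat.zero_le (CQ * T), Nat.zero_le (K * D * T), Nat.zero_le CQ]

/-! ### The composite verifier -/

/-- The relation of the new verifier: the inner relation on `f x` and the witness cut at the
admissible certificate length `c' · 2^{⌊|f x|^{1/r'}⌋} + c'` of the inner verifier. [folklore] -/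
def newRel (f : List Bool → List Bool) (r' c' : ℕ) (R' : List Bool → List Bool → Bool)
    (x y : List Bool) : Bool :=
  R' (f x) (y.take (c' * 2 ^ Nat.nthRoot r' (f x).length + c'))

/-- **The composite verifier and its running time.** Given the inner verifier `M'` (deciding
`R' w z` on `boolPair w z` within `c' · 2^{⌊|w|^{1/r'}⌋} + c'` steps for certificates inside that
bound), the machine `truncMapAux N ⨟ M'` over the clock `N` of `exists_clockMachine` decides
`newRel` on `boolPair x y` within
`|y|/2 + B + q(|x|) + P(|f x|) + K · 2^{⌊|f x|^{1/r'}⌋} + 3|f x| + 2B + 2|x| + 11` steps,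
`B = c' · 2^{⌊|f x|^{1/r'}⌋} + c'`, for EVERY witness `y`. [cite: AroraBarakCC2009, Thm. 2.8 (proof)] -/
theorem outputsWithin_verifier {f : List Bool → List Bool} (hf : f ∈ FP) {r' : ℕ} (hr' : r' ≠ 0)
    (c' : ℕ) (R' : List Bool → List Bool → Bool) (M' : TM2ComputableAux Bool Bool)
    (hM' : ∀ w z : List Bool, z.length ≤ c' * 2 ^ Nat.nthRoot r' w.length + c' →
      M'.OutputsWithin (boolPair w z) (encodeBool (R' w z)) (c' * 2 ^ Nat.nthRoot r' w.length + c')) :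
    ∃ (q P : Polynomial ℕ) (K : ℕ) (V : TM2ComputableAux Bool Bool), ∀ x y : List Bool,
      V.OutputsWithin (boolPair x y) (encodeBool (newRel f r' c' R' x y))
        (y.length / 2 + (c' * 2 ^ Nat.nthRoot r' (f x).length + c' +
          (q.eval x.length + P.eval (f x).length + K * 2 ^ Nat.nthRoot r' (f x).length +
            3 * (f x).length + 2 * (c' * 2 ^ Nat.nthRoot r' (f x).length + c') +
            2 * x.length + 11))) := by
  obtain ⟨q, P, K, N, hN⟩ := exists_clockMachine hf hr' c'
  refine ⟨q, P, K, (truncMapAux N).comp M', fun x y => ?_⟩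
  set B := c' * 2 ^ Nat.nthRoot r' (f x).length + c' with hB
  -- stage 1: compute `f x` and the clock, cut the witness
  have hclock : N.OutputsWithin x (boolPair (f x) (List.replicate B true))
      (q.eval x.length + P.eval (f x).length + K * 2 ^ Nat.nthRoot r' (f x).length) := hN x
  have h₁ := outputsWithin_truncMapAux_boolPair N (y := y) hclock
  simp only [List.length_replicate] at h₁
  -- stage 2: the inner verifier, inside its admissible range
  have h₂ : M'.OutputsWithin (boolPair (f x) (y.take B)) (encodeBool (R' (f x) (y.take B))) B :=
    hM' (f x) (y.take B) (List.length_take_le _ _)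
  have h := TM2ComputableAux.comp_outputsWithin (truncMapAux N) M' h₁ h₂
  have hrel : newRel f r' c' R' x y = R' (f x) (y.take B) := rfl
  rw [hrel]
  refine h.mono ?_
  omega

end KarpClock

/-! ### The discharge -/

open KarpClock in
/-- **Discharge of `NSUBEXP_of_karpReducible`**: `L ≤ₚ L' → L' ∈ NSUBEXP → L ∈ NSUBEXP`
(Kabanets–Impagliazzo 2003, §2.1 and the proof of Cor. 12, p. 358, in the tree's verifier-form
`NTIME`): for the reduction `f ∈ FP` with `|f x| ≤ A n^d + A` and `r ≥ 1`, the composite verifier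
`truncMapAux (U ⨟ N₀) ⨟ M'` over the member `r' = 2dr` of the presentation of `L'`
(`KarpClock.outputsWithin_verifier`) decides `newRel` within `c · 2^{⌊n^{1/r}⌋} + c` steps on all
witnesses of length `≤ c · 2^{⌊n^{1/r}⌋} + c` (`KarpClock.exists_time_bound`), and `newRel`
presents `L`: `x ∈ L ↔ f x ∈ L' ↔` some certificate inside the bound of `M'`, which is its own
truncation and fits in the budget.
[cite: KabanetsImpagliazzo2003, §2.1 (p. 357) and proof of Cor. 12 (p. 358)] -/
theorem NSUBEXP_of_karpReducible_holds : NSUBEXP_of_karpReducible := by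
  intro L L' hLL' hL'
  obtain ⟨f, hf, hred⟩ := hLL'
  rw [mem_NSUBEXP_iff]
  intro r hr
  have hr0 : r ≠ 0 := Nat.pos_iff_ne_zero.1 hr
  obtain ⟨A, d, hd, hA⟩ := exists_length_le_of_mem_FP hf
  have hr'0 : 2 * d * r ≠ 0 := Nat.mul_ne_zero (Nat.mul_ne_zero two_ne_zero hd) hr0
  obtain ⟨c', R', M', hM', hiff'⟩ := mem_NSUBEXP_iff.1 hL' (2 * d * r) (Nat.pos_of_ne_zero hr'0)
  dsimp only at hM' hiff'
  obtain ⟨q, P, K, V, hV⟩ := outputsWithin_verifier hf hr'0 c' R' M' hM'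
  obtain ⟨Cb, hCb⟩ := exists_time_bound q P K c' A hd hr0
  refine ⟨2 * Cb + 2, newRel f (2 * d * r) c' R', V, fun x y hy => ?_, fun x => ?_⟩
  · -- running time
    refine (hV x y).mono ?_
    have h1 := (hCb x.length (f x).length (hA x)).1
    set T := 2 ^ Nat.nthRoot r x.length with hT
    have e1 : (2 * Cb + 2) * T + (2 * Cb + 2) = 2 * (Cb * T) + 2 * T + 2 * Cb + 2 := by ring
    change y.length ≤ (2 * Cb + 2) * T + (2 * Cb + 2) at hy
    change _ ≤ (2 * Cb + 2) * T + (2 * Cb + 2)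
    rw [e1] at hy ⊢
    omega
  · -- the relation presents `L` (`x ∈ L ↔ f x ∈ L' ↔ ∃ z` inside the bound of `M'`)
    refine (hred x).trans ((hiff' (f x)).trans ?_)
    constructor
    · rintro ⟨z, hz, hRz⟩
      refine ⟨z, ?_, ?_⟩
      · have h2 := (hCb x.length (f x).length (hA x)).2
        set T := 2 ^ Nat.nthRoot r x.length with hT
        have e1 : (2 * Cb + 2) * T + (2 * Cb + 2) = 2 * (Cb * T) + 2 * T + 2 * Cb + 2 := by ring
        change _ ≤ (2 * Cb + 2) * T + (2 * Cb + 2)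
        rw [e1]
        omega
      · change R' (f x) (z.take (c' * 2 ^ Nat.nthRoot (2 * d * r) (f x).length + c')) = true
        rwa [List.take_of_length_le hz]
    · rintro ⟨y, -, hR⟩
      exact ⟨_, List.length_take_le _ _, hR⟩

end Literature.Computability.Complexity
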